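import Mathlib
import HarnessLib

/-!
# Hilbert–Schmidt separability probability of two-qubit X-states (Milz–Strunz 2015: `2/5`)

Topic `Literature/Probability/RandomMatrix` (Hilbert–Schmidt = Lebesgue volumes of spectrahedra of
quantum states), companion to `TwoQubitSeparabilityVolumes.lean` (`29/64`, `8/33`) and
`LovasAndaiDefectFunction.lean`. ONE NAMED FACT (D-0014, statement only, `def … : Prop`),
requested by route `Summit.KontsevichZagierPeriods.KontsevichZagierPeriods.Theses.SpectrahedralScissors`
(item `XStates25`, stmt-KontsevichZagierPeriods-9271), whose statement quantifies over exactly the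
chart used here.

## What is printed

S. Milz, W. T. Strunz, *Volumes of conditioned bipartite state spaces*, J. Phys. A 48 (2015)
035306, published online December 2014 — hence the bib key [MilzStrunz2014] (held: arXiv:1408.3666,
read §4–5 and Appendices A–B). Two-qubit X-states
(non-zero entries only on the diagonal and the anti-diagonal) form a seven-dimensional family; for
the sub-family whose reduced state has Bloch radius `r = a₃` they compute, in their Pauli coordinates
`(b₃, c₁₁, c₂₂, c₁₂, c₂₁, c₃₃)`, **App. A**: `V_euclid^{(X)}(a₃) = (2/9) π² (1 − a₃²)³` (linear chart
`(x, X, y, Y, z, Z)` with Jacobian `(1 − a₃²)³/8`, two disc areas `π r²`, `π R²`, `r² = (1+Z)(1−z)`,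
`R² = (1−Z)(1+z)`), hence `V_HS^{(X)}(r) = π²/2304 · (1 − r²)³` and `V_HS^{(X)} = π²/5040` (§5);
**App. B**: "for X-states the partial transpose with respect to the second qubit merely changes the
signs of `c₁₂` and `c₂₂`", so PPT (= separable, Peres–Horodecki) adds `x² + y² ≤ R²`, `X² + Y² ≤ r²`,
and `V_euclid,sep^{(X)} = (π²/8)(1 − a₃²)³ ∫∫ min(r², R²)² = (4/45) π² (1 − a₃²)³`; **§5, eq. for
`p_sep^{(X)}`**: "`p_sep^{(X)}(r) = 2/5, r ∈ [0,1)` and `p_sep^{(X)}(1) = 1`" — "the probability to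
find a separable state in a conditioned state space `𝓜^{(X)}_r` is independent of the reduced state".
Integrating the two conditioned volumes over `r` (both `∝ (1 − r²)³`) gives the unconditioned
Hilbert–Schmidt separability probability of X-states, `2/5` (re-derived by Dunkl–Slater 2015).

## Rendering

An X-state `ρ = [[a,0,0,w],[0,b,z,0],[0,z̄,c,0],[w̄,0,0,d]]`, `a + b + c + d = 1`, is written in the
entry chart `y = (a, b, c, Re w, Im w, Re z, Im z) ∈ ℝ⁷` (`d = 1 − a − b − c`), a linear image of the
Milz–Strunz Pauli chart (constant Jacobian), so the printed RATIO of Hilbert–Schmidt volumes is the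
ratio of coordinate `volume`s; the fact is stated cross-multiplied in `ℝ≥0∞` (both bodies bounded).
Positivity of an X-state splits into its two `2 × 2` blocks: `ρ ≽ 0 ⟺ a, b, c, d ≥ 0 ∧ |w|² ≤ a d ∧
|z|² ≤ b c`; the partial transpose exchanges the off-diagonal roles, `ρ^Γ ≽ 0 ⟺ |w|² ≤ b c ∧
|z|² ≤ a d` in addition (closed bodies; the boundary is Lebesgue-null and not asserted here). This is
exactly the pair of domains of the route item.

## Tree search

`Literature/Probability/RandomMatrix/TwoQubitSeparabilityVolumes.lean` holds the `29/64` and `8/33`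
facts and `LovasAndaiDefectFunction.lean` Lovas–Andai's `χ₁`; nothing on X-states
(`lean search 'xState|MilzStrunz|X-state'`: no hits in Mathlib/Literature).

## References

* [MilzStrunz2014] S. Milz, W. T. Strunz, J. Phys. A 48 (2015) 035306, §5 (eq. for `p_sep^{(X)}`),
  App. A (eq. `V_euclid^{(X)}`), App. B (eq. `V_euclid,sep^{(X)}`). arXiv:1408.3666.
-/

noncomputable section

open MeasureTheory
open scoped ENNReal

namespace Literature.Probability.RandomMatrix

/-! ### Chart -/

/-- The body of two-qubit X-states in the entry chart `y = (a, b, c, Re w, Im w, Re z, Im z) ∈ ℝ⁷`,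
`d = 1 − a − b − c`: `ρ ≽ 0 ⟺ a, b, c, d ≥ 0 ∧ |w|² ≤ a d ∧ |z|² ≤ b c` (the two `2 × 2` blocks
`[[a, w], [w̄, d]]`, `[[b, z], [z̄, c]]` are positive semidefinite).
[cite: MilzStrunz2014, §5 and App. A (the X-state family)] -/
def xStateBody : Set (Fin 7 → ℝ) :=
  {y | 0 ≤ y 0 ∧ 0 ≤ y 1 ∧ 0 ≤ y 2 ∧ 0 ≤ 1 - y 0 - y 1 - y 2 ∧
    y 3 ^ 2 + y 4 ^ 2 ≤ y 0 * (1 - y 0 - y 1 - y 2) ∧ y 5 ^ 2 + y 6 ^ 2 ≤ y 1 * y 2}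

/-- The PPT (= separable, Peres–Horodecki) X-states: the partial transpose of an X-state exchanges
the roles of `w` and `z` ("merely changes the signs of `c₁₂` and `c₂₂`"), so `ρ^Γ ≽ 0` adds
`|w|² ≤ b c ∧ |z|² ≤ a d`. [cite: MilzStrunz2014, App. B (PPT for X-states)] -/
def xStatePPTBody : Set (Fin 7 → ℝ) :=
  {y | (0 ≤ y 0 ∧ 0 ≤ y 1 ∧ 0 ≤ y 2 ∧ 0 ≤ 1 - y 0 - y 1 - y 2 ∧
      y 3 ^ 2 + y 4 ^ 2 ≤ y 0 * (1 - y 0 - y 1 - y 2) ∧ y 5 ^ 2 + y 6 ^ 2 ≤ y 1 * y 2) ∧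
    (y 3 ^ 2 + y 4 ^ 2 ≤ y 1 * y 2 ∧ y 5 ^ 2 + y 6 ^ 2 ≤ y 0 * (1 - y 0 - y 1 - y 2))}

/-! ### Named fact -/

/-- **Milz–Strunz 2015, §5 with Appendices A–B (X-state separability probability `2/5`).**
"`p_sep^{(X)}(r) = V_HS,sep^{(X)}(r) / V_HS^{(X)}(r) = 2/5` for `r ∈ [0,1)`" (the Hilbert–Schmidt
probability of a separable = PPT state among the two-qubit X-states whose reduced state has Bloch
radius `r`, from `V_euclid^{(X)}(a₃) = (2/9)π²(1−a₃²)³`, App. A, and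
`V_euclid,sep^{(X)} = (4/45)π²(1−a₃²)³`, App. B); integrated over `r` it is the unconditioned ratio
`vol₇(PPT X-states) / vol₇(X-states) = 2/5`, rendered cross-multiplied on the entry chart `ℝ⁷`
(module docstring: constant Jacobian to the HS measure). Grounds the value side of
`Summit.KontsevichZagierPeriods.KontsevichZagierPeriods.Theses.SpectrahedralScissors.XStates25`.
[cite: MilzStrunz2014, §5 (p_sep^(X) = 2/5) with App. A–B] -/
def MilzStrunz2014_xState_separability_probability : Prop :=
  5 * volume xStatePPTBody = 2 * volume xStateBody

/-! ### Sanity lemmas -/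

/-- The PPT X-body is the X-body cut by the two exchanged disc conditions. [folklore] -/
theorem xStatePPTBody_eq_inter :
    xStatePPTBody = xStateBody ∩
      {y | y 3 ^ 2 + y 4 ^ 2 ≤ y 1 * y 2 ∧ y 5 ^ 2 + y 6 ^ 2 ≤ y 0 * (1 - y 0 - y 1 - y 2)} := rfl

/-- The PPT X-body is contained in the X-body. [folklore] -/
theorem xStatePPTBody_subset : xStatePPTBody ⊆ xStateBody := fun _ hy => hy.1

/-- Every coordinate `a, b, c` of an X-state lies in `[0, 1]` (so the bodies are bounded).
[folklore] -/
theorem mem_xStateBody_le_one {y : Fin 7 → ℝ} (hy : y ∈ xStateBody) :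
    y 0 ≤ 1 ∧ y 1 ≤ 1 ∧ y 2 ≤ 1 := by
  obtain ⟨h0, h1, h2, h3, -, -⟩ := hy
  exact ⟨by linarith, by linarith, by linarith⟩

end Literature.Probability.RandomMatrix

end
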